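import Summits.HubbardSuperconductivity.HubbardSuperconductivity.Theorems.NodalWardXYPerturbedXYOrderTiltedBounds
import Summits.HubbardSuperconductivity.HubbardSuperconductivity.Theorems.NodalWardXYPerturbedXYOrderEquivalence

/-!
# Engine statement, T-RG-native format (crux stmt-HubbardSuperconductivity-10739, line schwarz-inheritance, lead c13)

Planner-facing, farm-checked companion of `Cruxes/PerturbedXYOrder/EngineStatement.lean` (lead c4: `ComplexStabilityXY3`).
Since skeleton rev 12/13 (lead c12) the single registered stub of the only eligible line is no longer `ComplexStabilityXY3`
(≡ the crux, p106199) but its LOCAL-OBSERVABLE form `stub_tiltedCorrelationBounds` — the native output format of the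
unwritten volume-uniform low-temperature multiscale expansion for complex two-body tilts ("T-RG"; Balaban 1995–98 /
Balaban–O'Carroll 1999 class, unprinted for complex perturbations).  This file names that statement
(`TiltedCorrelationBoundsXY3`) and records the landed one-line closers, so that a route planner can file ONE `@[conjecture]`
engine item in either format and make `PerturbedXYOrder` a conditional bridge on it (HANDBACK-c12 §5 A′, HANDBACK-c13):

* `TiltedCorrelationBoundsXY3 → ComplexStabilityXY3'` (`complexStability_of_tiltedCorrelationBounds`, p141548);
* `TiltedCorrelationBoundsXY3 → PerturbedXYOrder` (`perturbedXYOrder_of_tiltedCorrelationBounds`, p141548);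
* `ComplexStabilityXY3' ↔ PerturbedXYOrder` (`perturbedXYOrder_iff_complexStability`, p106199).

`TiltedCorrelationBoundsXY3` is formally STRONGER than the crux (it bounds every tilted pair-current and two-point value, the crux
only their `K`-weighted / site-averaged combinations); no converse is claimed.  Vocabulary = `Theorems/NodalWardXYDefs.lean`
(p76365).  WORKFILE (Cruxes/), not a Theorems proposal: filing statement items is the planner's call (D-0014); nothing here is
new mathematics.
-/

namespace Summit.HubbardSuperconductivity.HubbardSuperconductivity.Cruxes.PerturbedXYOrder.Engine

open MeasureTheory Literature.Probability.LatticeModels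
open Summit.HubbardSuperconductivity.HubbardSuperconductivity.Theses.NodalWardXY
open Summit.HubbardSuperconductivity.HubbardSuperconductivity.Theorems.PerturbedXYOrder

/-- **TiltedCorrelationBoundsXY3** (the engine in T-RG-native format; open, Balaban class).  Low-temperature classical XY model on
`(ℤ/Lℤ)³` tilted by a complex two-current kernel with `(1+dist)⁻⁴` tails: there are `J₀`, `ε₂ > 0`, `C > 0` such that for all
`J ≥ J₀`, all `L ≥ 2` and every admissible `K` with `Z_K ≠ 0`, the complex tilted state `⟨F⟩_K = ∫_cube F w_J e^{W_K} / Z_K`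
satisfies `‖⟨j_b j_b'⟩_K‖ ≤ C` for all bond pairs and `‖⟨cos(θ_x − θ_y)⟩_K‖ ≤ C` for all site pairs — uniformly in the volume.
Verbatim the registered stub `stub_tiltedCorrelationBounds` (skeleton rev 13, sha f5b5b8874f13). -/
def TiltedCorrelationBoundsXY3 : Prop :=
  ∃ J₀ ε₂ C : ℝ, 0 < ε₂ ∧ 0 < C ∧ ∀ J : ℝ, J₀ ≤ J → ∀ (L : ℕ) [NeZero L], 2 ≤ L →
    ∀ K : Bond L → Bond L → ℂ, Admissible L ε₂ K → Zk J K ≠ 0 →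
      (∀ b b' : Bond L,
        ‖(∫ θ in cube L, (cur b θ : ℂ) * (cur b' θ : ℂ) * (wJ J θ * Complex.exp (Wk K θ))) / Zk J K‖ ≤ C) ∧
      (∀ x y : TorusSite 3 L,
        ‖(∫ θ in cube L, (Real.cos (θ x - θ y) : ℂ) * (wJ J θ * Complex.exp (Wk K θ))) / Zk J K‖ ≤ C)

/-- **ComplexStabilityXY3'** (lead c4's engine format, restated here so that this file does not depend on
`EngineStatement.lean`): `Z_K ≠ 0 ∧ ‖num_K/Z_K/L⁶‖ ≤ B` uniformly.  ≡ `PerturbedXYOrder` (p106199). -/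
def ComplexStabilityXY3' : Prop :=
  ∃ J₀ ε₂ B : ℝ, 0 < ε₂ ∧ 0 < B ∧ ∀ J : ℝ, J₀ ≤ J → ∀ (L : ℕ) [NeZero L], 2 ≤ L →
    ∀ K : Bond L → Bond L → ℂ, Admissible L ε₂ K → Zk J K ≠ 0 ∧ ‖cratio L J K‖ ≤ B

/-- T-RG format ⇒ c4 format (log-derivative continuity along the admissible ray; landed p141548). -/
theorem complexStabilityXY3'_of_tilted (h : TiltedCorrelationBoundsXY3) : ComplexStabilityXY3' :=
  complexStability_of_tiltedCorrelationBounds h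

/-- The crux from the engine in T-RG format (one line; this is how `PerturbedXYOrder` closes once the engine item lands). -/
theorem perturbedXYOrder_of_tiltedEngine (h : TiltedCorrelationBoundsXY3) : PerturbedXYOrder :=
  perturbedXYOrder_of_tiltedCorrelationBounds h

/-- c4 format ⇔ the crux (landed p106199; Schwarz inheritance one way, Borel–Carathéodory the other). -/
theorem complexStabilityXY3'_iff : ComplexStabilityXY3' ↔ PerturbedXYOrder :=
  perturbedXYOrder_iff_complexStability.symm

end Summit.HubbardSuperconductivity.HubbardSuperconductivity.Cruxes.PerturbedXYOrder.Engine
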